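import Literature.Computability.Complexity.CodeFPArith
import HarnessLib

/-!
# Typed polynomial time on codes, III: polynomial unit budgets, logarithms, filters, integer folds

Trunk `CplxCore`, continuing `CodeFP.lean` and `CodeFPArith.lean` (the algebra `CodeFP eα eβ g` of
maps computed on codes by `FP` string functions; unit budgets `replicateUnit`, integers `intE`).
The further combinators an arithmetic decision procedure needs (first client: the machine form of
the Allen–O'Donnell–Witmer refuter, `AOWMachine*.lean`):

* **polynomial unit budgets**: `unitsMul`, `unitsPow c` (`1ⁿ ↦ n^c` units), `unitsOfNatMin`
  (a binary numeral capped by a budget, as units);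
* **finite conjunctions** `decideForallList`, `decideForallFintype` (a `decide (∀ i, P i a)` over a
  finite index type from the decisions of the instances) and **`filter`**;
* **sizes of numerals** (`length_natE = Nat.size` and its behaviour under `+`, `*`, `^`, sums);
* **binary logarithm** `natLog2Min` (`(x, l) ↦ min |l| (log₂ x)` by the capped doubling scan);
* **integer folds**: `intSum` (sums of raw lists), `intPowLen` (`(z, l) ↦ z^{|l|}`), with the
  polynomial accumulator bounds of `CodeFP.foldl` discharged by the size lemmas.

## References

* S. Arora, B. Barak, *Computational Complexity: A Modern Approach*, CUP 2009, §1.3 (closure of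
  polynomial time under composition and polynomially bounded loops), §0.1 (codes).
* D. E. Knuth, *The Art of Computer Programming*, Vol. 2, 3rd ed., 1998, §4.3.1, §4.6.3.
-/

namespace Literature.Computability.Complexity

namespace CodeFP

open _root_.Computability Polynomial Brick

variable {α β γ δ σ : Type} {eα : α → List Bool} {eβ : β → List Bool} {eγ : γ → List Bool}
  {eσ : σ → List Bool}

/-! ### Polynomial unit budgets -/

/-- Every list of units is a `replicate`. [folklore] -/
theorem eq_replicate_unit (l : List Unit) : l = List.replicate l.length () :=
  List.eq_replicate_iff.2 ⟨rfl, fun _ _ => rfl⟩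

/-- **Product of unit budgets**: `(u, v) ↦ |u| · |v|` units. [cite: AroraBarak2009, §1.3] -/
theorem unitsMul : CodeFP (pairE (rawE unitE) (rawE unitE)) (rawE unitE)
    (fun p => List.replicate (p.1.length * p.2.length) ()) := by
  have h := ((flatten unitE).comp ((map (g := fun t : List Unit × Unit => t.1) (fst _ _)).comp
    ((snd (rawE unitE) (rawE unitE)).pair (fst _ _))))
  refine h.congr fun p => ?_
  refine List.eq_replicate_iff.2 ⟨?_, fun _ _ => rfl⟩
  simp [List.length_flatten, List.sum_replicate]

/-- **Polynomial unit budgets**: `1ⁿ ↦ n^c` units. [cite: AroraBarak2009, §1.3] -/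
theorem unitsPow : ∀ c : ℕ, CodeFP unE (rawE unitE) (fun n => List.replicate (n ^ c) ())
  | 0 => (const unE [()]).congr fun n => by simp
  | c + 1 => (unitsMul.comp ((unitsPow c).pair replicateUnit)).congr fun n => by
      simp [pow_succ]

/-- **A binary numeral as units, capped by a budget**: `(u, N) ↦ min N |u|` units. [cite: AroraBarak2009, §1.3] -/
theorem unitsOfNatMin : CodeFP (pairE (rawE unitE) natE) (rawE unitE)
    (fun p => List.replicate (min p.2 p.1.length) ()) :=
  ((map₀ (const natE ())).comp (brange unitE)).congr fun p => by
    refine List.eq_replicate_iff.2 ⟨by simp, fun _ _ => rfl⟩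

/-! ### Finite conjunctions and filters -/

/-- A `decide (∀ i ∈ l, P i a)` over a list of indices, from the decisions of the instances. [folklore] -/
theorem decideForallList {ι : Type} {P : ι → α → Prop} [∀ i a, Decidable (P i a)] :
    ∀ l : List ι, (∀ i ∈ l, CodeFP eα bitE (fun a => decide (P i a))) →
      CodeFP eα bitE (fun a => decide (∀ i ∈ l, P i a))
  | [], _ => (const eα true).congr fun a => by simp
  | i :: l, h => ((h i (List.mem_cons_self ..)).and
      (decideForallList l fun j hj => h j (List.mem_cons_of_mem _ hj))).congr fun a => by
        simp [Bool.decide_and]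

/-- **A `decide (∀ i, P i a)` over a finite index type**, from the decisions of the instances.
[cite: AroraBarak2009, §1.3 (finitely many polynomial-time tests)] -/
theorem decideForallFintype {ι : Type} [Fintype ι] {P : ι → α → Prop} [∀ i a, Decidable (P i a)]
    (h : ∀ i, CodeFP eα bitE (fun a => decide (P i a))) :
    CodeFP eα bitE (fun a => decide (∀ i, P i a)) :=
  (decideForallList (Finset.univ : Finset ι).toList fun i _ => h i).congr fun a => by
    simp

/-- The filtering fold. [folklore] -/
theorem foldl_filter_eq (p : α → Bool) (l acc : List α) :
    l.foldl (fun acc a => if p a then acc ++ [a] else acc) acc = acc ++ l.filter p := by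
  induction l generalizing acc with
  | nil => simp
  | cons a l ih =>
    rw [List.foldl_cons, ih, List.filter_cons]
    cases p a <;> simp

/-- **`filter` with a context over raw lists.** [cite: AroraBarak2009, §1.3] -/
theorem filter {p : σ × α → Bool} (hp : CodeFP (pairE eσ eα) bitE p) :
    CodeFP (pairE eσ (rawE eα)) (rawE eα) (fun q => q.2.filter (fun a => p (q.1, a))) := by
  have hA : CodeFP (pairE eσ (pairE eα (rawE eα))) (rawE eα) (fun t => t.2.2) := (snd _ _).snd'
  have ha : CodeFP (pairE eσ (pairE eα (rawE eα))) eα (fun t => t.2.1) := (snd _ _).fst'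
  have hB : CodeFP (pairE eσ (pairE eα (rawE eα))) bitE (fun t => p (t.1, t.2.1)) :=
    hp.comp₂ (fst _ _) ha
  have hstep : CodeFP (pairE eσ (pairE eα (rawE eα))) (rawE eα)
      (fun t => if p (t.1, t.2.1) then t.2.2 ++ [t.2.1] else t.2.2) :=
    hB.ite ((rawAppend eα).comp (hA.pair ((rawSingleton eα).comp ha))) hA
  have h := foldl (step := fun s a acc => if p (s, a) then acc ++ [a] else acc) (init := fun _ => [])
    hstep (const eσ []) X (fun s l₁ l₂ => by
      rw [foldl_filter_eq, List.nil_append, eval_X]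
      simp only [pairE_apply, length_boolPair]
      have h1 := length_rawE_le_of_sublist eα ((List.filter_sublist (p := fun a => p (s, a)) (l := l₁)).trans
        (List.sublist_append_left l₁ l₂))
      omega)
  exact h.congr fun q => by rw [foldl_filter_eq, List.nil_append]

/-! ### Sizes of numerals -/

/-- `|natE n| = Nat.size n`. [folklore] -/
theorem length_natE (n : ℕ) : (natE n).length = Nat.size n := TM2Pass.length_encodeNat_eq_size n

/-- `size (a + b) ≤ max (size a) (size b) + 1`. [folklore] -/
theorem size_add_le (a b : ℕ) : Nat.size (a + b) ≤ max (Nat.size a) (Nat.size b) + 1 := by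
  rw [Nat.size_le]
  have ha := Nat.lt_size_self a
  have hb := Nat.lt_size_self b
  have h1 : 2 ^ Nat.size a ≤ 2 ^ max (Nat.size a) (Nat.size b) := Nat.pow_le_pow_right (by norm_num) (le_max_left _ _)
  have h2 : 2 ^ Nat.size b ≤ 2 ^ max (Nat.size a) (Nat.size b) := Nat.pow_le_pow_right (by norm_num) (le_max_right _ _)
  rw [pow_succ]
  omega

/-- `size (a b) ≤ size a + size b`. [folklore] -/
theorem size_mul_le (a b : ℕ) : Nat.size (a * b) ≤ Nat.size a + Nat.size b := by
  rw [Nat.size_le, pow_add]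
  exact Nat.mul_lt_mul'' (Nat.lt_size_self a) (Nat.lt_size_self b)

/-- `size (a^i) ≤ i · size a + 1`. [folklore] -/
theorem size_pow_le (a i : ℕ) : Nat.size (a ^ i) ≤ i * Nat.size a + 1 := by
  rw [Nat.size_le]
  have h : a ^ i ≤ (2 ^ Nat.size a) ^ i := Nat.pow_le_pow_left (Nat.lt_size_self a).le i
  calc a ^ i ≤ 2 ^ (i * Nat.size a) := by rw [mul_comm, pow_mul]; exact h
    _ < 2 ^ (i * Nat.size a + 1) := Nat.pow_lt_pow_right (by norm_num) (Nat.lt_succ_self _)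

/-- `size` is monotone (re-export). [folklore] -/
theorem size_mono {a b : ℕ} (h : a ≤ b) : Nat.size a ≤ Nat.size b := Nat.size_le_size h

/-- Size of a sum of a list: at most the number of items above a common bound on their sizes. [folklore] -/
theorem size_sum_le {l : List ℕ} {M : ℕ} (h : ∀ x ∈ l, Nat.size x ≤ M) : Nat.size l.sum ≤ l.length + M := by
  induction l with
  | nil => simp
  | cons a l ih =>
    rw [List.sum_cons, List.length_cons]
    have ha := h a (List.mem_cons_self ..)
    have hl := ih fun x hx => h x (List.mem_cons_of_mem _ hx)
    have := size_add_le a l.sum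
    omega

/-! ### Binary logarithms by the capped doubling scan -/

/-- The state of the capped doubling scan after `i` rounds: `(2^r, r)` with `r = min i (log₂ x)`. [folklore] -/
def log2State (x i : ℕ) : ℕ × ℕ := (2 ^ min i (Nat.log 2 x), min i (Nat.log 2 x))

/-- One round of the capped doubling scan. [folklore] -/
def log2Step (x : ℕ) (st : ℕ × ℕ) : ℕ × ℕ := if st.1 * 2 ≤ x then (st.1 * 2, st.2 + 1) else st

/-- The scan computes `log2State`. [folklore] -/
theorem foldl_log2Step (x : ℕ) (l : List Unit) : ∀ i : ℕ,
    l.foldl (fun st _ => log2Step x st) (log2State x i) = log2State x (i + l.length) := by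
  induction l with
  | nil => intro i; simp
  | cons a l ih =>
    intro i
    rw [List.foldl_cons, List.length_cons, show i + (l.length + 1) = (i + 1) + l.length by omega, ← ih (i + 1)]
    congr 1
    simp only [log2Step, log2State]
    by_cases hi : i + 1 ≤ Nat.log 2 x
    · have hx : x ≠ 0 := by rintro rfl; simp at hi
      rw [min_eq_left (by omega : i ≤ Nat.log 2 x), min_eq_left hi, if_pos]
      · rw [pow_succ]
      · rw [← pow_succ]
        exact Nat.pow_le_of_le_log hx hi
    · push Not at hi
      rw [min_eq_right (by omega : Nat.log 2 x ≤ i), min_eq_right (by omega : Nat.log 2 x ≤ i + 1), if_neg]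
      rw [← pow_succ, not_le]
      exact Nat.lt_pow_succ_log_self (by norm_num) x

/-- **Binary logarithm by the capped doubling scan**: `(x, l) ↦ min |l| (log₂ x)` (so `= log₂ x` once the
budget has `log₂ x ≤ |l|` units). [cite: AroraBarak2009, §1.3] -/
theorem natLog2Min : CodeFP (pairE natE (rawE unitE)) natE (fun p => min p.2.length (Nat.log 2 p.1)) := by
  let stE : ℕ × ℕ → List Bool := pairE natE natE
  have hP : CodeFP (pairE natE (pairE unitE stE)) natE (fun t => t.2.2.1) := (snd _ _).snd'.fst'
  have hR : CodeFP (pairE natE (pairE unitE stE)) natE (fun t => t.2.2.2) := (snd _ _).snd'.snd'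
  have hP2 : CodeFP (pairE natE (pairE unitE stE)) natE (fun t => t.2.2.1 * 2) := natMul.comp (hP.pair (const _ 2))
  have hstep : CodeFP (pairE natE (pairE unitE stE)) stE (fun t => log2Step t.1 t.2.2) :=
    ((natLe.comp (hP2.pair (fst _ _))).ite (hP2.pair (natAdd.comp (hR.pair (const _ 1)))) (snd _ _).snd').congr
      fun t => by simp only [log2Step, decide_eq_true_eq]
  have h := foldl (step := fun x (_ : Unit) st => log2Step x st) (init := fun x => log2State x 0) hstep
    ((const natE (1, 0)).congr fun x => by simp [log2State]) (3 * X + 4) (fun x l₁ l₂ => by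
      rw [foldl_log2Step, Nat.zero_add, pairE_apply, length_boolPair]
      simp only [stE, pairE_apply, length_boolPair, log2State, eval_add, eval_mul, eval_X, eval_ofNat]
      have hr : min l₁.length (Nat.log 2 x) ≤ x := (min_le_right _ _).trans (Nat.log_le_self 2 x)
      have hp : 2 ^ min l₁.length (Nat.log 2 x) ≤ max 1 x := by
        rcases Nat.eq_zero_or_pos x with rfl | hx
        · simp
        · exact (Nat.pow_le_pow_right (by norm_num) (min_le_right _ _)).trans
            ((Nat.pow_log_le_self 2 hx.ne').trans (le_max_right _ _))
      have h1 : (natE (2 ^ min l₁.length (Nat.log 2 x))).length ≤ (natE x).length + 1 := by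
        rw [length_natE, length_natE]
        refine (size_mono hp).trans ?_
        rcases le_total 1 x with h | h
        · rw [max_eq_right h]; omega
        · rw [max_eq_left h]; simp
      have h2 : (natE (min l₁.length (Nat.log 2 x))).length ≤ (natE x).length := by
        rw [length_natE, length_natE]; exact size_mono hr
      omega)
  exact h.snd'.congr fun p => by
    rw [foldl_log2Step p.1 p.2 0]
    simp only [log2State, Nat.zero_add]

/-! ### Integer folds -/

/-- The size of `|z|` is within the code of `z`. [folklore] -/
theorem size_natAbs_le_length_intE (z : ℤ) : Nat.size z.natAbs ≤ (intE z).length := by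
  simp only [intE, dpEnc, length_boolPair, TM2Pass.length_encodeNat_eq_size]
  rcases le_total 0 z with h | h
  · have : z.natAbs = z.toNat := by omega
    rw [this]; omega
  · have : z.natAbs = (-z).toNat := by omega
    rw [this]; omega

/-- The summing fold. [folklore] -/
theorem foldl_add_eq_sum_int (l : List ℤ) (acc : ℤ) : l.foldl (fun acc a => acc + a) acc = acc + l.sum := by
  induction l generalizing acc with
  | nil => simp
  | cons a l ih => rw [List.foldl_cons, ih, List.sum_cons]; ring

/-- `|∑ l| ≤ ∑ |·|` for integer lists, in `ℕ`. [folklore] -/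
theorem natAbs_sum_le (l : List ℤ) : l.sum.natAbs ≤ (l.map Int.natAbs).sum := by
  induction l with
  | nil => simp
  | cons a l ih => rw [List.sum_cons, List.map_cons, List.sum_cons]; exact (Int.natAbs_add_le _ _).trans (by omega)

/-- **Sums of raw lists of integers.** [cite: AroraBarak2009, §1.3] -/
theorem intSum : CodeFP (rawE intE) intE List.sum := by
  have hstep : CodeFP (pairE intE intE) intE (fun t => t.2 + t.1) := (intAdd.comp ((snd _ _).pair (fst _ _)) :)
  have h := foldl₀ (step := fun (a : ℤ) acc => acc + a) (b₀ := 0) hstep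
    (6 * X + 2) (fun l₁ l₂ => by
      rw [foldl_add_eq_sum_int, zero_add]
      simp only [eval_add, eval_mul, eval_X, eval_ofNat]
      set L := (rawE intE (l₁ ++ l₂)).length
      have hitem : ∀ z ∈ l₁, Nat.size z.natAbs ≤ L := fun z hz =>
        (size_natAbs_le_length_intE z).trans ((by omega : (intE z).length ≤ 2 * (intE z).length + 2).trans
          (length_item_le_length_rawE intE (List.mem_append_left l₂ hz)))
      have hlen : l₁.length ≤ L := le_trans (by simp) (length_le_length_rawE intE (l₁ ++ l₂))
      have h1 := length_dpEnc_le l₁.sum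
      have h2 : Nat.size l₁.sum.natAbs ≤ l₁.length + L := by
        refine (size_mono (natAbs_sum_le l₁)).trans ((size_sum_le (M := L) fun x hx => ?_).trans (by simp))
        obtain ⟨z, hz, rfl⟩ := List.mem_map.1 hx
        exact hitem z hz
      change (dpEnc l₁.sum).length ≤ _
      omega)
  exact h.congr fun l => by rw [foldl_add_eq_sum_int, zero_add]

/-- The integer power fold. [folklore] -/
theorem foldl_mul_const_eq_int (x : ℤ) (l : List Unit) (acc : ℤ) :
    l.foldl (fun acc _ => acc * x) acc = acc * x ^ l.length := by
  induction l generalizing acc with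
  | nil => simp
  | cons a l ih => rw [List.foldl_cons, ih, List.length_cons, pow_succ']; ring

/-- **Integer powers by a unit budget**: `(z, l) ↦ z^{|l|}`. [cite: AroraBarak2009, §1.3;
KnuthTAOCP2, §4.6.3] -/
theorem intPowLen : CodeFP (pairE intE (rawE unitE)) intE (fun p => p.1 ^ p.2.length) := by
  have hg : CodeFP (pairE intE (pairE unitE intE)) (pairE intE intE) (fun t => (t.2.2, t.1)) :=
    (snd _ _).snd'.pair (fst _ _)
  have hstep : CodeFP (pairE intE (pairE unitE intE)) intE (fun t => t.2.2 * t.1) := (intMul.comp hg :)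
  have h := foldl (step := fun x (_ : Unit) acc => acc * x) (init := fun _ => (1 : ℤ)) hstep (const intE 1)
    (3 * (X * X + 1) + 2) (fun x l₁ l₂ => by
      have hf : List.foldl (fun (b : ℤ) (_ : Unit) => b * x) 1 l₁ = x ^ l₁.length := by
        rw [foldl_mul_const_eq_int, one_mul]
      simp only [hf, pairE_apply, length_boolPair, eval_add, eval_mul, eval_X, eval_one, eval_ofNat]
      have h1 := length_dpEnc_le (x ^ l₁.length)
      rw [Int.natAbs_pow] at h1
      have h2 := size_pow_le x.natAbs l₁.length
      have h3 : l₁.length ≤ (rawE unitE (l₁ ++ l₂)).length :=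
        le_trans (by simp) (length_le_length_rawE unitE (l₁ ++ l₂))
      have h4 := size_natAbs_le_length_intE x
      set L := 2 * (intE x).length + 2 + (rawE unitE (l₁ ++ l₂)).length
      have h5 : l₁.length * Nat.size x.natAbs ≤ L * L := Nat.mul_le_mul (by omega) (by omega)
      change (dpEnc (x ^ l₁.length)).length ≤ _
      omega)
  exact h.congr fun p => by rw [foldl_mul_const_eq_int, one_mul]

/-- Integer powers by a unary exponent. [cite: KnuthTAOCP2, §4.6.3] -/
theorem intPow : CodeFP (pairE intE unE) intE (fun p => p.1 ^ p.2) :=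
  (intPowLen.comp ((fst _ _).pair (replicateUnit.comp (snd _ _)))).congr fun p => by simp

end CodeFP

end Literature.Computability.Complexity
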